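/-
Copyright (c) 2026 the pub-hodgecm-mathlib formalisation cell (harness21).  Prover seat hodgecm-mathlib-K2E3-p06 (g2), Track B «K2-LIT» ∕ h413,
ENGINE E3 unit U4 «Keys», SIGS-TABLE row #6 `sig_K2E3IrregularReducibleCaseThree` — analytic letter hKP, brick F4 (a `σ`-even additive character and the transform of the
truncated test function).
-/
import Summits.HodgeConjecture.HodgeConjecture.Theorems.K2E3SkewLineZetaFibration   -- ★ brick F3 (this seat): frame, `Re ∕ Im` of `a + y`, compact balls; brings ★ F2
import Literature.NumberTheory.Automorphic.TateLocalSchwartzBruhat               -- ★ `fourierSB`, `AddChar.IsContinuousNontrivial`, conductor balls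
import Mathlib.MeasureTheory.Integral.Prod
import HarnessLib

/-!
# K2 · E3 · U4 «Keys», row #6 — brick F4: a `σ`-EVEN additive character `ψ` of `E` (`ψ ∘ σ = ψ`) is trivial on `E⁻`, so `ψ((a+y)(a'+y')) = ψ(aa')ψ(yy')` and the Fourier
# transform of `g_T(x) = Φ(Re x)𝟙[‖Im x‖ ≤ T]` is the PRODUCT `(∫_{E⁺} ψ(a Re β)Φ(a)) · (∫_{‖y‖ ≤ T} ψ(y Im β))`; orthogonality on the balls of `E^±`
# [Tate1950 §2.2, §2.5; WeilBNT1967 II §5; Keys1984 §5]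

Cell `pub/hodgecm-mathlib` (D-0151), HCML Track B «K2-LIT», crux H413 = `stmt-HodgeConjecture-24833` (lane `--supports … --as helper`), route
HCCMUnconditional; socket `sig_K2E3IrregularReducibleCaseThree` (U4-c) of `Cruxes/H413/Lines/K2_E3_EllipticInputsSigs_U4Keys.lean`.
THEOREMS ONLY (0 def ∕ 0 instance ∕ 0 notation ∕ 0 sorry); ★-only imports.  FRAME of ★ brick F2 (`E` non-archimedean local field, `σ` continuous isometric involution,
`2 ∈ Eˣ`, `E^± = fixedPart ∕ skewPart σ`, regular Haar `μ^±`, `μ_E = (μ⁺ ⊗ μ⁻) ∘ ringDecomp⁻¹`), and an additive character `ψ : E → 𝕊` with `ψ(σ x) = ψ(x)` — for hKP: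
`ψ = ψ_w(x₀ · (x + σ x))` built from the adelic character at the place `w` (brick F5); Tate's Fubini trick at `s = 0` (★ F1) needs the transform of `g_T` EXPLICITLY, and `σ`-evenness
is what makes it a product.
* §1 `addChar_eq_one_of_skew` (`ψ|_{E⁻} = 1`: `ψ(y) = ψ(y/2)²` and `ψ(y/2) = ψ(σ(y/2)) = ψ(y/2)⁻¹`), **`addChar_mul_add_eq`** (`ψ((a+y)(a'+y')) = ψ(aa')·ψ(yy')`),
  `exists_fixed_addChar_ne_one` (a fixed `a₁ ≠ 0` with `ψ(a₁) ≠ 1` when `ψ ≠ 1`);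
* §2 annihilators of balls are small: **`normAbs_lt_of_forall_skew_addChar_mul_eq_one`** (`ψ(y y') = 1 ∀ skew ‖y‖ ≤ T ⇒ ‖y'‖ < ‖a₁‖/T`), its `E⁺` twin
  `normAbs_lt_of_forall_fixed_addChar_mul_eq_one`, and large: `forall_addChar_mul_eq_one_of_normAbs_le` (`‖y‖ ≤ T, ‖y'‖ ≤ r_ψ/T ⇒ ψ(yy') = 1`);
* §3 ORTHOGONALITY on the compact open balls: **`integral_skewBall_addChar_mul`** (`∫_{‖y‖ ≤ T} ψ(y y') dμ⁻ = μ⁻(ball)` if `ψ(· y') ≡ 1` there, else `0`) and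
  **`integral_fixedBall_addChar_mul`** (the same on `E⁺`) — Tate's averaging argument over a subgroup;
* §4 **`fourierSB_truncTest_eq_mul`** — `(g_T)^(β) = (∫_{E⁺} ψ(a · ½(β+σβ)) Φ(a) dμ⁺) · (∫_{E⁻} 𝟙[‖y‖ ≤ T] ψ(y · ½(β−σβ)) dμ⁻)` for `μ_E = (μ⁺ ⊗ μ⁻) ∘ ringDecomp⁻¹`.
HONEST LABEL: HC_CM is proved only modulo the 7 printed citations (2 remaining named inputs: hLiu418 = `stmt-HodgeConjecture-24832`, h413 =
`stmt-HodgeConjecture-24833`) until rung 0 closes; count-neutral analytic plumbing (no socket paid here).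

## References
* [Tate1950] J. Tate, *Fourier analysis in number fields and Hecke's zeta-functions* (1950), §2.2 (characters and Fourier transform), §2.5 (the averaging argument:
  a character integrates to `0` over a compact subgroup on which it is non-trivial).
* [WeilBNT1967] A. Weil, *Basic Number Theory* (1967), Ch. II §5 (characters of local fields, annihilators of lattices).
* [Keys1984] D. Keys, *Principal series representations of special unitary groups over local fields*, Compositio Math. 51 (1984), §5.
-/

set_option autoImplicit false
-- the mandated namespace has the single-problem summit's repeated segment (`HodgeConjecture.HodgeConjecture`)
set_option linter.dupNamespace false

noncomputable section

open scoped NNReal ENNReal Topology Pointwise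
open MeasureTheory Filter Set
open Literature.NumberTheory.GaloisRepresentations.IsNonarchimedeanLocalField
open Literature.NumberTheory.Automorphic
open Literature.NumberTheory.Automorphic.UnitaryGroup.HeisRing
open Summit.HodgeConjecture.HodgeConjecture.Cruxes.H413.K2E3SkewLineIntegrable
open Summit.HodgeConjecture.HodgeConjecture.Cruxes.H413.K2E3SkewLineZetaFibration

namespace Summit.HodgeConjecture.HodgeConjecture.Cruxes.H413.K2E3SigmaEvenCharacter

variable {E : Type*} [Field E] [ValuativeRel E] [TopologicalSpace E] [IsNonarchimedeanLocalField E]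
  (σ : E →+* E) (hσ : ∀ x, σ (σ x) = x) (hσc : Continuous σ) [Invertible (2 : E)]
  (hσn : ∀ x, normAbs E (σ x) = normAbs E x)
  (ψ : AddChar E Circle) (hψσ : ∀ x, ψ (σ x) = ψ x)

/-! ## §1 A `σ`-even additive character is trivial on `E⁻`; the product formula -/

section Even

omit [ValuativeRel E] [TopologicalSpace E] [IsNonarchimedeanLocalField E] in
include hψσ in
/-- **`ψ(y) = 1` for `y ∈ E⁻`** when `ψ ∘ σ = ψ`: with `z = y/2` (skew), `ψ(z) = ψ(σ z) = ψ(−z) = ψ(z)⁻¹`, so `ψ(y) = ψ(z)² = ψ(z)ψ(z)⁻¹ = 1`. [cite: WeilBNT1967, Ch. II §5] -/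
theorem addChar_eq_one_of_skew {y : E} (hy : σ y = -y) : ψ y = 1 := by
  set z : E := ⅟(2 : E) * y with hz
  have hzs : σ z = -z := by rw [hz, map_mul, map_invOf_two σ, hy, mul_neg]
  have h1 : ψ z = (ψ z)⁻¹ := by rw [← AddChar.map_neg_eq_inv, ← hzs, hψσ]
  have hy2 : y = z + z := by
    have h2 : (⅟(2 : E)) * 2 = 1 := invOf_mul_self _
    rw [hz]; linear_combination (-y) * h2
  have hzz : ψ z * ψ z = 1 := by
    nth_rewrite 2 [h1]
    exact mul_inv_cancel (ψ z)
  rw [hy2, AddChar.map_add_eq_mul, hzz]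

omit [ValuativeRel E] [TopologicalSpace E] [IsNonarchimedeanLocalField E] in
include hψσ in
/-- **`ψ((a+y)(a'+y')) = ψ(a a') · ψ(y y')`** for `a, a'` fixed and `y, y'` skew: the cross term `a y' + y a'` is skew and killed by §1. [cite: Tate1950, §2.2] -/
theorem addChar_mul_add_eq {a a' y y' : E} (ha : σ a = a) (ha' : σ a' = a') (hy : σ y = -y) (hy' : σ y' = -y') :
    ψ ((a + y) * (a' + y')) = ψ (a * a') * ψ (y * y') := by
  have hsk : σ (a * y' + y * a') = -(a * y' + y * a') := by rw [map_add, map_mul, map_mul, ha, ha', hy, hy']; ring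
  have hsplit : (a + y) * (a' + y') = (a * a' + y * y') + (a * y' + y * a') := by ring
  rw [hsplit, AddChar.map_add_eq_mul, addChar_eq_one_of_skew σ ψ hψσ hsk, mul_one, AddChar.map_add_eq_mul]

omit [ValuativeRel E] [TopologicalSpace E] [IsNonarchimedeanLocalField E] in
include hσ hψσ in
/-- **A fixed `a₁ ≠ 0` with `ψ(a₁) ≠ 1`** when `ψ` is non-trivial and `σ`-even: decompose a witness `x = Re x + Im x`; `ψ(Im x) = 1`. [cite: WeilBNT1967, Ch. II §5] -/
theorem exists_fixed_addChar_ne_one (hψ1 : ψ ≠ 0) : ∃ a₁ : E, σ a₁ = a₁ ∧ a₁ ≠ 0 ∧ ψ a₁ ≠ 1 := by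
  obtain ⟨x, hx⟩ := DFunLike.ne_iff.1 hψ1
  rw [AddChar.zero_apply] at hx
  have h2 : (⅟(2 : E)) * 2 = 1 := invOf_mul_self _
  set a : E := ⅟(2 : E) * (x + σ x) with hadef
  set y : E := ⅟(2 : E) * (x - σ x) with hydef
  have ha : σ a = a := by rw [hadef, map_mul, map_invOf_two σ, map_add, hσ, add_comm]
  have hy : σ y = -y := by rw [hydef, map_mul, map_invOf_two σ, map_sub, hσ]; ring
  have hxy : x = a + y := by rw [hadef, hydef]; linear_combination (-x) * h2
  have hψa : ψ a ≠ 1 := by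
    intro h
    apply hx
    rw [hxy, AddChar.map_add_eq_mul, h, addChar_eq_one_of_skew σ ψ hψσ hy, one_mul]
  refine ⟨a, ha, fun h0 => hψa (by rw [h0, AddChar.map_zero_eq_one]), hψa⟩

end Even

/-! ## §2 Annihilators of balls: small from above, large from below -/

section Annihilator

omit [Invertible (2 : E)] in
/-- **The annihilator of the `T`-ball of `E⁻` is small**: if `ψ(y y') = 1` for every skew `y` with `‖y‖ ≤ T` (`T > 0`) and `y'` is skew, then `‖y'‖ < ‖a₁‖/T` for any fixed
`a₁ ≠ 0` with `ψ(a₁) ≠ 1` (else `y = a₁/y'` is a skew element of the ball with `y y' = a₁`). [cite: WeilBNT1967, Ch. II §5] -/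
theorem normAbs_lt_of_forall_skew_addChar_mul_eq_one {a₁ : E} (ha₁ : σ a₁ = a₁) (hψa₁ : ψ a₁ ≠ 1)
    {T : ℝ≥0} (hT : 0 < T) {y' : E} (hy' : σ y' = -y') (h : ∀ y : E, σ y = -y → normAbs E y ≤ T → ψ (y * y') = 1) :
    normAbs E y' < normAbs E a₁ / T := by
  by_contra hle
  push Not at hle
  have ha₁0 : a₁ ≠ 0 := fun h0 => hψa₁ (by rw [h0, AddChar.map_zero_eq_one])
  have hpos : 0 < normAbs E a₁ / T := div_pos (pos_iff_ne_zero.2 ((map_ne_zero _).2 ha₁0)) hT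
  have hy'0 : y' ≠ 0 := fun h0 => by rw [h0, map_zero] at hle; exact absurd hle (not_le.2 hpos)
  have hny' : 0 < normAbs E y' := pos_iff_ne_zero.2 ((map_ne_zero _).2 hy'0)
  have hskew : σ (a₁ * y'⁻¹) = -(a₁ * y'⁻¹) := by rw [map_mul, map_inv₀, ha₁, hy', inv_neg, mul_neg]
  have hnorm : normAbs E (a₁ * y'⁻¹) ≤ T := by
    rw [map_mul, map_inv₀, mul_inv_le_iff₀ hny']
    rwa [div_le_iff₀ hT, mul_comm] at hle
  have := h _ hskew hnorm
  rw [inv_mul_cancel_right₀ hy'0] at this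
  exact hψa₁ this

omit [Invertible (2 : E)] in
/-- **The annihilator of the `ρ`-ball of `E⁺` is small**: if `ψ(a t) = 1` for every fixed `a` with `‖a‖ ≤ ρ` (`ρ > 0`) and `t` is fixed, then `‖t‖ < ‖a₁‖/ρ`.
[cite: WeilBNT1967, Ch. II §5] -/
theorem normAbs_lt_of_forall_fixed_addChar_mul_eq_one {a₁ : E} (ha₁ : σ a₁ = a₁) (hψa₁ : ψ a₁ ≠ 1)
    {ρ : ℝ≥0} (hρ : 0 < ρ) {t : E} (ht : σ t = t) (h : ∀ a : E, σ a = a → normAbs E a ≤ ρ → ψ (a * t) = 1) :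
    normAbs E t < normAbs E a₁ / ρ := by
  by_contra hle
  push Not at hle
  have ha₁0 : a₁ ≠ 0 := fun h0 => hψa₁ (by rw [h0, AddChar.map_zero_eq_one])
  have hpos : 0 < normAbs E a₁ / ρ := div_pos (pos_iff_ne_zero.2 ((map_ne_zero _).2 ha₁0)) hρ
  have ht0 : t ≠ 0 := fun h0 => by rw [h0, map_zero] at hle; exact absurd hle (not_le.2 hpos)
  have hnt : 0 < normAbs E t := pos_iff_ne_zero.2 ((map_ne_zero _).2 ht0)
  have hfix : σ (a₁ * t⁻¹) = a₁ * t⁻¹ := by rw [map_mul, map_inv₀, ha₁, ht]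
  have hnorm : normAbs E (a₁ * t⁻¹) ≤ ρ := by
    rw [map_mul, map_inv₀, mul_inv_le_iff₀ hnt]
    rwa [div_le_iff₀ hρ, mul_comm] at hle
  have := h _ hfix hnorm
  rw [inv_mul_cancel_right₀ ht0] at this
  exact hψa₁ this

omit [Invertible (2 : E)] in
/-- **The annihilator of the `T`-ball contains the `r_ψ/T`-ball**: if `ψ = 1` on `{‖z‖ ≤ r_ψ}` then `ψ(y y') = 1` whenever `‖y‖ ≤ T` and `‖y'‖ ≤ r_ψ / T`.
[cite: Tate1950, §2.2] -/
theorem addChar_mul_eq_one_of_normAbs_le {rψ : ℝ≥0} (hrψ : ∀ z : E, normAbs E z ≤ rψ → ψ z = 1) {T : ℝ≥0} (hT : 0 < T)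
    {y y' : E} (hy : normAbs E y ≤ T) (hy' : normAbs E y' ≤ rψ / T) : ψ (y * y') = 1 := by
  refine hrψ _ ?_
  rw [map_mul]
  calc normAbs E y * normAbs E y' ≤ T * (rψ / T) := mul_le_mul' hy hy'
    _ = rψ := mul_div_cancel₀ _ hT.ne'

end Annihilator

/-! ## §3 Orthogonality on the balls of `E⁻` and `E⁺` -/

section Orthogonality

variable [MeasurableSpace E] [BorelSpace E]

open scoped Classical in
omit [Invertible (2 : E)] in
/-- **ORTHOGONALITY ON THE `T`-BALL OF `E⁻`**: `∫_{E⁻} 𝟙[‖y‖ ≤ T] ψ(y y') dμ⁻(y)` is `μ⁻{‖y‖ ≤ T}` if `ψ(y y') = 1` for all skew `y` in the ball, and `0` otherwise — Tate's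
averaging over the compact open subgroup `{‖y‖ ≤ T}` (a subgroup by the ultrametric inequality; shift by a `y₀` with `ψ(y₀ y') ≠ 1`). [cite: Tate1950, §2.5] -/
theorem integral_skewBall_addChar_mul (μm : Measure (skewPart σ)) [μm.IsAddLeftInvariant] (T : ℝ≥0) (y' : E) :
    ∫ y : skewPart σ, {y : skewPart σ | normAbs E (y : E) ≤ T}.indicator (fun y : skewPart σ => ((ψ ((y : E) * y') : Circle) : ℂ)) y ∂μm =
      if (∀ y : skewPart σ, normAbs E (y : E) ≤ T → ψ ((y : E) * y') = 1) then ((μm.real {y : skewPart σ | normAbs E (y : E) ≤ T} : ℝ) : ℂ) else 0 := by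
  have hmeas : MeasurableSet {y : skewPart σ | normAbs E (y : E) ≤ T} :=
    measurableSet_le (LocalFieldHaar.continuous_normAbs.measurable.comp measurable_subtype_coe) measurable_const
  split_ifs with hall
  · have h1 : {y : skewPart σ | normAbs E (y : E) ≤ T}.indicator (fun y : skewPart σ => ((ψ ((y : E) * y') : Circle) : ℂ)) =
        {y : skewPart σ | normAbs E (y : E) ≤ T}.indicator (fun _ => (1 : ℂ)) := by
      funext y
      by_cases hy : y ∈ {y : skewPart σ | normAbs E (y : E) ≤ T}
      · rw [Set.indicator_of_mem hy, Set.indicator_of_mem hy, hall y hy, Circle.coe_one]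
      · rw [Set.indicator_of_notMem hy, Set.indicator_of_notMem hy]
    rw [h1, integral_indicator_const _ hmeas, Complex.real_smul, mul_one]
  · push Not at hall
    obtain ⟨y₀, hy₀, hne⟩ := hall
    have hne' : ((ψ ((y₀ : E) * y') : Circle) : ℂ) ≠ 1 := fun h => hne (Circle.coe_eq_one.1 h)
    have hshift : ∀ y : skewPart σ, {y : skewPart σ | normAbs E (y : E) ≤ T}.indicator (fun y : skewPart σ => ((ψ ((y : E) * y') : Circle) : ℂ)) (y₀ + y) =
        ((ψ ((y₀ : E) * y') : Circle) : ℂ) * {y : skewPart σ | normAbs E (y : E) ≤ T}.indicator (fun y : skewPart σ => ((ψ ((y : E) * y') : Circle) : ℂ)) y := by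
      intro y
      by_cases hy : y ∈ {y : skewPart σ | normAbs E (y : E) ≤ T}
      · have hy0y : y₀ + y ∈ {y : skewPart σ | normAbs E (y : E) ≤ T} := by
          show normAbs E (((y₀ + y : skewPart σ)) : E) ≤ T
          rw [AddSubgroup.coe_add]
          exact (normAbs_add_le_max _ _).trans (max_le hy₀ hy)
        rw [Set.indicator_of_mem hy0y, Set.indicator_of_mem hy, AddSubgroup.coe_add, add_mul, AddChar.map_add_eq_mul, Circle.coe_mul]
      · have hy0y : y₀ + y ∉ {y : skewPart σ | normAbs E (y : E) ≤ T} := by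
          intro h
          apply hy
          show normAbs E (y : E) ≤ T
          have : (y : E) = ((y₀ + y : skewPart σ) : E) + -(y₀ : E) := by rw [AddSubgroup.coe_add]; ring
          rw [this]
          exact (normAbs_add_le_max _ _).trans (max_le h (by rw [normAbs_neg]; exact hy₀))
        rw [Set.indicator_of_notMem hy0y, Set.indicator_of_notMem hy, mul_zero]
    have key : ∫ y, {y : skewPart σ | normAbs E (y : E) ≤ T}.indicator (fun y : skewPart σ => ((ψ ((y : E) * y') : Circle) : ℂ)) y ∂μm =
        ((ψ ((y₀ : E) * y') : Circle) : ℂ) * ∫ y, {y : skewPart σ | normAbs E (y : E) ≤ T}.indicator (fun y : skewPart σ => ((ψ ((y : E) * y') : Circle) : ℂ)) y ∂μm := by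
      rw [← integral_const_mul, ← integral_add_left_eq_self _ y₀]
      exact integral_congr_ae (Eventually.of_forall hshift)
    have h5 : (1 - ((ψ ((y₀ : E) * y') : Circle) : ℂ)) *
        ∫ y, {y : skewPart σ | normAbs E (y : E) ≤ T}.indicator (fun y : skewPart σ => ((ψ ((y : E) * y') : Circle) : ℂ)) y ∂μm = 0 := by
      rw [sub_mul, one_mul, ← key, sub_self]
    exact (mul_eq_zero.1 h5).resolve_left (sub_ne_zero.2 (Ne.symm hne'))

open scoped Classical in
omit [Invertible (2 : E)] in
/-- **ORTHOGONALITY ON THE `ρ`-BALL OF `E⁺`**: `∫_{E⁺} 𝟙[‖a‖ ≤ ρ] ψ(a t) dμ⁺(a)` is `μ⁺{‖a‖ ≤ ρ}` if `ψ(a t) = 1` on the ball, and `0` otherwise. [cite: Tate1950, §2.5] -/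
theorem integral_fixedBall_addChar_mul (μp : Measure (fixedPart σ)) [μp.IsAddLeftInvariant] (ρ : ℝ≥0) (t : E) :
    ∫ a : fixedPart σ, {a : fixedPart σ | normAbs E (a : E) ≤ ρ}.indicator (fun a : fixedPart σ => ((ψ ((a : E) * t) : Circle) : ℂ)) a ∂μp =
      if (∀ a : fixedPart σ, normAbs E (a : E) ≤ ρ → ψ ((a : E) * t) = 1) then ((μp.real {a : fixedPart σ | normAbs E (a : E) ≤ ρ} : ℝ) : ℂ) else 0 := by
  have hmeas : MeasurableSet {a : fixedPart σ | normAbs E (a : E) ≤ ρ} :=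
    measurableSet_le (LocalFieldHaar.continuous_normAbs.measurable.comp measurable_subtype_coe) measurable_const
  split_ifs with hall
  · have h1 : {a : fixedPart σ | normAbs E (a : E) ≤ ρ}.indicator (fun a : fixedPart σ => ((ψ ((a : E) * t) : Circle) : ℂ)) =
        {a : fixedPart σ | normAbs E (a : E) ≤ ρ}.indicator (fun _ => (1 : ℂ)) := by
      funext a
      by_cases ha : a ∈ {a : fixedPart σ | normAbs E (a : E) ≤ ρ}
      · rw [Set.indicator_of_mem ha, Set.indicator_of_mem ha, hall a ha, Circle.coe_one]
      · rw [Set.indicator_of_notMem ha, Set.indicator_of_notMem ha]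
    rw [h1, integral_indicator_const _ hmeas, Complex.real_smul, mul_one]
  · push Not at hall
    obtain ⟨a₀, ha₀, hne⟩ := hall
    have hne' : ((ψ ((a₀ : E) * t) : Circle) : ℂ) ≠ 1 := fun h => hne (Circle.coe_eq_one.1 h)
    have hshift : ∀ a : fixedPart σ, {a : fixedPart σ | normAbs E (a : E) ≤ ρ}.indicator (fun a : fixedPart σ => ((ψ ((a : E) * t) : Circle) : ℂ)) (a₀ + a) =
        ((ψ ((a₀ : E) * t) : Circle) : ℂ) * {a : fixedPart σ | normAbs E (a : E) ≤ ρ}.indicator (fun a : fixedPart σ => ((ψ ((a : E) * t) : Circle) : ℂ)) a := by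
      intro a
      by_cases ha : a ∈ {a : fixedPart σ | normAbs E (a : E) ≤ ρ}
      · have ha0a : a₀ + a ∈ {a : fixedPart σ | normAbs E (a : E) ≤ ρ} := by
          show normAbs E (((a₀ + a : fixedPart σ)) : E) ≤ ρ
          rw [AddSubgroup.coe_add]
          exact (normAbs_add_le_max _ _).trans (max_le ha₀ ha)
        rw [Set.indicator_of_mem ha0a, Set.indicator_of_mem ha, AddSubgroup.coe_add, add_mul, AddChar.map_add_eq_mul, Circle.coe_mul]
      · have ha0a : a₀ + a ∉ {a : fixedPart σ | normAbs E (a : E) ≤ ρ} := by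
          intro h
          apply ha
          show normAbs E (a : E) ≤ ρ
          have : (a : E) = ((a₀ + a : fixedPart σ) : E) + -(a₀ : E) := by rw [AddSubgroup.coe_add]; ring
          rw [this]
          exact (normAbs_add_le_max _ _).trans (max_le h (by rw [normAbs_neg]; exact ha₀))
        rw [Set.indicator_of_notMem ha0a, Set.indicator_of_notMem ha, mul_zero]
    have key : ∫ a, {a : fixedPart σ | normAbs E (a : E) ≤ ρ}.indicator (fun a : fixedPart σ => ((ψ ((a : E) * t) : Circle) : ℂ)) a ∂μp =
        ((ψ ((a₀ : E) * t) : Circle) : ℂ) * ∫ a, {a : fixedPart σ | normAbs E (a : E) ≤ ρ}.indicator (fun a : fixedPart σ => ((ψ ((a : E) * t) : Circle) : ℂ)) a ∂μp := by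
      rw [← integral_const_mul, ← integral_add_left_eq_self _ a₀]
      exact integral_congr_ae (Eventually.of_forall hshift)
    have h5 : (1 - ((ψ ((a₀ : E) * t) : Circle) : ℂ)) *
        ∫ a, {a : fixedPart σ | normAbs E (a : E) ≤ ρ}.indicator (fun a : fixedPart σ => ((ψ ((a : E) * t) : Circle) : ℂ)) a ∂μp = 0 := by
      rw [sub_mul, one_mul, ← key, sub_self]
    exact (mul_eq_zero.1 h5).resolve_left (sub_ne_zero.2 (Ne.symm hne'))

end Orthogonality

/-! ## §4 The Fourier transform of `g_T(x) = Φ(Re x) 𝟙[‖Im x‖ ≤ T]` is a product -/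

section Transform

variable [MeasurableSpace E] [BorelSpace E] [T2Space E] [SecondCountableTopology E]
  (μp : Measure (fixedPart σ)) [μp.IsAddHaarMeasure] (μm : Measure (skewPart σ)) [μm.IsAddHaarMeasure]

include hψσ in
/-- **`(g_T)^ = (Φ-part on E⁺) × (ball part on E⁻)`**: for `μ_E = (μ⁺ ⊗ μ⁻) ∘ ringDecomp⁻¹` and EVERY `Φ : E → ℂ`, `T`, `β`,
`∫_E ψ(xβ) Φ(½(x+σx)) 𝟙[‖½(x−σx)‖ ≤ T] dμ_E(x) = (∫_{E⁺} ψ(a · ½(β+σβ)) Φ(a) dμ⁺(a)) · (∫_{E⁻} 𝟙[‖y‖ ≤ T] ψ(y · ½(β−σβ)) dμ⁻(y))` — by §1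
`ψ((a+y)β) = ψ(a Re β) ψ(y Im β)`, then `∫ f(a) g(y) d(μ⁺ ⊗ μ⁻) = ∫ f · ∫ g`. [cite: Tate1950, §2.2] [cite: Keys1984, §5] -/
theorem fourierSB_truncTest_eq_mul (Φ : E → ℂ) (T : ℝ≥0) (β : E) :
    fourierSB ψ ((μp.prod μm).map (ringDecomp σ hσ hσc).symm)
        (fun x => Φ (⅟(2 : E) * (x + σ x)) * {y : E | normAbs E y ≤ T}.indicator (fun _ => (1 : ℂ)) (⅟(2 : E) * (x - σ x))) β =
      (∫ a : fixedPart σ, ((ψ ((a : E) * (⅟(2 : E) * (β + σ β))) : Circle) : ℂ) * Φ (a : E) ∂μp) *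
        ∫ y : skewPart σ, {y : skewPart σ | normAbs E (y : E) ≤ T}.indicator
          (fun y : skewPart σ => ((ψ ((y : E) * (⅟(2 : E) * (β - σ β))) : Circle) : ℂ)) y ∂μm := by
  haveI := locallyCompactSpace_fixedPart σ hσc
  haveI := locallyCompactSpace_skewPart σ hσc
  haveI : SecondCountableTopology (fixedPart σ) := TopologicalSpace.Subtype.secondCountableTopology _
  haveI : SecondCountableTopology (skewPart σ) := TopologicalSpace.Subtype.secondCountableTopology _
  have h2 : (⅟(2 : E)) * 2 = 1 := invOf_mul_self _
  set a' : E := ⅟(2 : E) * (β + σ β) with ha'def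
  set y' : E := ⅟(2 : E) * (β - σ β) with hy'def
  have ha' : σ a' = a' := by rw [ha'def, map_mul, map_invOf_two σ, map_add, hσ, add_comm]
  have hy' : σ y' = -y' := by rw [hy'def, map_mul, map_invOf_two σ, map_sub, hσ]; ring
  have hβ : β = a' + y' := by rw [ha'def, hy'def]; linear_combination (-β) * h2
  set e := ringDecomp σ hσ hσc with he
  set meq : fixedPart σ × skewPart σ ≃ᵐ E := e.symm.toHomeomorph.toMeasurableEquiv with hmeq
  have hμ : ((μp.prod μm).map (ringDecomp σ hσ hσc).symm) = (μp.prod μm).map meq := rfl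
  rw [fourierSB_apply, hμ, integral_map_equiv meq]
  have hpt : ∀ p : fixedPart σ × skewPart σ,
      ((ψ ((meq p) * β) : Circle) : ℂ) * (Φ (⅟(2 : E) * (meq p + σ (meq p))) * {y : E | normAbs E y ≤ T}.indicator (fun _ => (1 : ℂ)) (⅟(2 : E) * (meq p - σ (meq p)))) =
        (((ψ (((p.1 : fixedPart σ) : E) * a') : Circle) : ℂ) * Φ ((p.1 : fixedPart σ) : E)) *
          {y : skewPart σ | normAbs E (y : E) ≤ T}.indicator (fun y : skewPart σ => ((ψ ((y : E) * y') : Circle) : ℂ)) p.2 := by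
    rintro ⟨a, y⟩
    have hav : meq (a, y) = (a : E) + (y : E) := rfl
    have ha : σ (a : E) = a := a.2
    have hy : σ (y : E) = -(y : E) := (mem_skewPart_iff σ _).1 y.2
    rw [hav, re_add σ ha hy, im_add σ ha hy, hβ, addChar_mul_add_eq σ ψ hψσ ha ha' hy hy', Circle.coe_mul]
    by_cases hyT : normAbs E (y : E) ≤ T
    · rw [Set.indicator_of_mem (show (y : E) ∈ {y : E | normAbs E y ≤ T} from hyT),
        Set.indicator_of_mem (show y ∈ {y : skewPart σ | normAbs E (y : E) ≤ T} from hyT)]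
      ring
    · rw [Set.indicator_of_notMem (show (y : E) ∉ {y : E | normAbs E y ≤ T} from hyT),
        Set.indicator_of_notMem (show y ∉ {y : skewPart σ | normAbs E (y : E) ≤ T} from hyT)]
      ring
  simp_rw [hpt]
  exact integral_prod_mul (fun a : fixedPart σ => ((ψ ((a : E) * a') : Circle) : ℂ) * Φ (a : E))
    (fun y : skewPart σ => {y : skewPart σ | normAbs E (y : E) ≤ T}.indicator (fun y : skewPart σ => ((ψ ((y : E) * y') : Circle) : ℂ)) y)

end Transform

end Summit.HodgeConjecture.HodgeConjecture.Cruxes.H413.K2E3SigmaEvenCharacter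

end
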